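import Summits.ABC.ABC.Theses.PadicPrincipalCoreRadThree
import Summits.ABC.StewartYu.GluePrincipalToPrime
import HarnessLib

/-!
# Route PadicPrincipalCoreRadThree, item `GlueSpec`: closed by the cell's glue theorem

`Summits/ABC/ABC/Theorems/PadicPrincipalCoreRadThreeGlue.lean` — cell `abc-stewartyu`, seat p3.
Same text as route PadicPrincipalCoreST86's `GlueSpec` (closed there by
`padicPrincipalCoreST86_glueSpec_proof`); proved again directly from the landed
`Summit.ABC.StewartYu.primePadicBoundAt_odd_of_principal` (`K = 4704`, `L = 32c₁`, `κ = c₂ + 2`).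
-/

set_option linter.dupNamespace false

namespace Summit.ABC.ABC.Theorems

/-- **Item `GlueSpec` of route PadicPrincipalCoreRadThree** (`K = 4704`, `L = 32c₁`, `κ = c₂ + 2`). [folklore] -/
theorem padicPrincipalCoreRadThree_glueSpec_proof :
    Summit.ABC.ABC.Theses.PadicPrincipalCoreRadThree.GlueSpec := by
  unfold Summit.ABC.ABC.Theses.PadicPrincipalCoreRadThree.GlueSpec
  intro hM C r c₁ c₂ hc₁ hc₂ hC hA
  refine ⟨4704, 32 * c₁, c₂ + 2, by norm_num, by linarith, by linarith, by linarith, ?_⟩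
  intro p hp hp2 n q e hq hinj hqp he hne1
  exact Summit.ABC.StewartYu.primePadicBoundAt_odd_of_principal hM hc₁ hC hA hp hp2 n q e hq hinj hqp
    he hne1

end Summit.ABC.ABC.Theorems
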